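import Mathlib

/-!
# The weighted two-point a priori estimate for a general three-term recurrence
# (kernel #236, lemmaR-A3 §8(z), PLAN §116)

Solo-blind programme, session s93.  Kernel #235 (`SoloBlindRecessiveTwoPoint`) recorded the
Casoratian / reduction-of-order / linear-closure algebra behind the non-resonance bound for the
SYMMETRIC streak recurrence `u (k+2) - 2 u (k+1) + u k = c (k+1) u (k+1)` (Jost lemma [L1]).
The roll Jost lemma [L2] concerns the TRANSPOSED ROLL RECURRENCE of kernel #233,
`(n-1) c (n+1) - 2n c n + (n+1) c (n-1) = n κ n c n` (sites `n ≥ 2`), which is not symmetric.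
This file records the same algebra for an ARBITRARY three-term recurrence
`a (k+1) u (k+2) + b (k+1) u (k+1) + d (k+1) u k = 0` with a SYMMETRISER `p`
(`p (k+1) a (k+1) = A (k+1)`, `p (k+1) d (k+1) = A k`), through the weighted Casoratian
`C k = A k (u k W (k+1) - W k u (k+1))`:

* one-step identity `C (k+1) = C k + p (k+1) u (k+1) τ (k+1)` (`τ` = defect of the comparison
  sequence `W`), its summed and tail forms (the recessive solution is fed from infinity);
* weighted reduction of order `u (k+1)/W (k+1) - u k/W k = - C k/(A k W k W (k+1))`, the
  two-point representation and the normed two-point estimate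
  `‖u k - u 0 W k‖ ≤ ‖W k‖ Σ_{j<k} ‖C j‖/(‖A j‖ ‖W j‖ ‖W (j+1)‖)` (normalisation `W 0 = 1`);
* the PRINGSHEIM (row-dominance) tail lemma for general coefficients: rows
  `d (k+1) v k + a (k+1) v (k+2) = b (k+1) v (k+1)`, truncation `v (M+2) = 0`,
  `‖a‖ + ‖d‖ ≤ ‖b‖`, `d ≠ 0` ⇒ `‖v (k+1)‖ ≤ ‖v k‖` on the tail;
* the ROLL INSTANCES: the symmetriser `p n = 6/((n-1) n (n+1))`, `A n = 6/(n (n+1))`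
  (written at sites `n = k+2`), the row-dominance criterion `‖2 + κ‖ ≥ 2` (the same Pringsheim
  index as the streak), the column-2 residual `F_r = (3i/4) c₁*` with `3 c₁* = (4 + 2κ₂) c₂ - c₃`
  (so the roll Jost datum is `D_r = F_r/c₂ = (3i/4) c₁*/c₂ → 3i/4`), and the datum-transfer
  identity `D_r - D_r^W = -(i/4) (u₃ - W₃)`.

The linear closure lemmas `apriori_closure`, `nonresonance_apriori` of kernel #235 apply verbatim.
Numerically (work/edge_s93/apriori3.py) the roll contraction constant is `θ*_r ≤ 0.089` at `P_max`
on `|Re x| ≤ 12, |Im x| ≤ 1/4`, and the comparison datum reproduces `κ_r = |D_r - 3i/4|/sc` to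
`2·10⁻⁴`; so [L2], like [L1], reduces to certified one-dimensional continuum constants.
-/

namespace Summit.AnomalousDissipation.AnomalousDissipation.Theorems

open Complex

/-- The weighted Casoratian of two sequences at site `k`. -/
def wcasoratian (A u W : ℕ → ℂ) (k : ℕ) : ℂ := A k * (u k * W (k + 1) - W k * u (k + 1))

/-- ONE-STEP WEIGHTED CASORATIAN IDENTITY. -/
theorem wcasoratian_step (A p a b d u W : ℕ → ℂ) (τ : ℂ) (k : ℕ)
    (hpa : p (k + 1) * a (k + 1) = A (k + 1)) (hpd : p (k + 1) * d (k + 1) = A k)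
    (hu : a (k + 1) * u (k + 2) + b (k + 1) * u (k + 1) + d (k + 1) * u k = 0)
    (hW : a (k + 1) * W (k + 2) + b (k + 1) * W (k + 1) + d (k + 1) * W k = τ) :
    wcasoratian A u W (k + 1) = wcasoratian A u W k + p (k + 1) * u (k + 1) * τ := by
  unfold wcasoratian
  rw [show k + 1 + 1 = k + 2 by ring, ← hpa, ← hpd, ← hW]
  linear_combination (- p (k + 1) * W (k + 1)) * hu

/-- SUMMED IDENTITY: `C k = C 0 + Σ_{j<k} p (j+1) u (j+1) τ (j+1)` for `k ≤ K`. -/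
theorem wcasoratian_sum (A p a b d u W τ : ℕ → ℂ) (K : ℕ)
    (hpa : ∀ k, p (k + 1) * a (k + 1) = A (k + 1)) (hpd : ∀ k, p (k + 1) * d (k + 1) = A k)
    (hu : ∀ k, k + 1 ≤ K → a (k + 1) * u (k + 2) + b (k + 1) * u (k + 1) + d (k + 1) * u k = 0)
    (hW : ∀ k, k + 1 ≤ K →
      a (k + 1) * W (k + 2) + b (k + 1) * W (k + 1) + d (k + 1) * W k = τ (k + 1)) :
    ∀ k, k ≤ K → wcasoratian A u W k
      = wcasoratian A u W 0 + (Finset.range k).sum (fun j => p (j + 1) * u (j + 1) * τ (j + 1)) := by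
  intro k
  induction k with
  | zero => intro _; simp
  | succ k ih =>
    intro hk
    rw [Finset.sum_range_succ,
      wcasoratian_step A p a b d u W (τ (k + 1)) k (hpa k) (hpd k) (hu k hk) (hW k hk), ih (by omega)]
    ring

/-- TAIL FORM: `C j = C M - Σ_{j ≤ i < M} p (i+1) u (i+1) τ (i+1)` (fed from infinity). -/
theorem wcasoratian_tail (A p a b d u W τ : ℕ → ℂ) (M : ℕ)
    (hpa : ∀ k, p (k + 1) * a (k + 1) = A (k + 1)) (hpd : ∀ k, p (k + 1) * d (k + 1) = A k)
    (hu : ∀ k, k + 1 ≤ M → a (k + 1) * u (k + 2) + b (k + 1) * u (k + 1) + d (k + 1) * u k = 0)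
    (hW : ∀ k, k + 1 ≤ M →
      a (k + 1) * W (k + 2) + b (k + 1) * W (k + 1) + d (k + 1) * W k = τ (k + 1))
    (j : ℕ) (hj : j ≤ M) :
    wcasoratian A u W j = wcasoratian A u W M
      - ((Finset.range M).sum (fun i => p (i + 1) * u (i + 1) * τ (i + 1))
          - (Finset.range j).sum (fun i => p (i + 1) * u (i + 1) * τ (i + 1))) := by
  have hM := wcasoratian_sum A p a b d u W τ M hpa hpd hu hW M le_rfl
  have hJ := wcasoratian_sum A p a b d u W τ M hpa hpd hu hW j hj
  linear_combination hJ - hM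

/-- WEIGHTED REDUCTION OF ORDER, one step. -/
theorem wreduction_of_order_step (A u W : ℕ → ℂ) (k : ℕ) (hA : A k ≠ 0) (h0 : W k ≠ 0)
    (h1 : W (k + 1) ≠ 0) :
    u (k + 1) / W (k + 1) - u k / W k = - wcasoratian A u W k / (A k * W k * W (k + 1)) := by
  unfold wcasoratian
  field_simp
  ring

/-- TWO-POINT REPRESENTATION (ratio form). -/
theorem wreduction_of_order_sum (A u W : ℕ → ℂ) (K : ℕ) (hA : ∀ j, j ≤ K → A j ≠ 0)
    (hW : ∀ j, j ≤ K → W j ≠ 0) :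
    ∀ k, k ≤ K → u k / W k
      = u 0 / W 0 - (Finset.range k).sum (fun j => wcasoratian A u W j / (A j * W j * W (j + 1))) := by
  intro k
  induction k with
  | zero => intro _; simp
  | succ k ih =>
    intro hk
    rw [Finset.sum_range_succ]
    have h := wreduction_of_order_step A u W k (hA k (by omega)) (hW k (by omega)) (hW (k + 1) hk)
    have h' := ih (by omega)
    linear_combination h + h'

/-- TWO-POINT REPRESENTATION (product form). -/
theorem wtwo_point_representation (A u W : ℕ → ℂ) (K : ℕ) (hA : ∀ j, j ≤ K → A j ≠ 0)
    (hW : ∀ j, j ≤ K → W j ≠ 0) (k : ℕ) (hk : k ≤ K) :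
    u k = W k * (u 0 / W 0
      - (Finset.range k).sum (fun j => wcasoratian A u W j / (A j * W j * W (j + 1)))) := by
  rw [← wreduction_of_order_sum A u W K hA hW k hk]
  field_simp [hW k hk]

/-- WEIGHTED TWO-POINT ESTIMATE (normalisation `W 0 = 1`). -/
theorem wtwo_point_estimate (A u W : ℕ → ℂ) (K : ℕ) (hA : ∀ j, j ≤ K → A j ≠ 0)
    (hW : ∀ j, j ≤ K → W j ≠ 0) (hW0 : W 0 = 1) (k : ℕ) (hk : k ≤ K) :
    ‖u k - u 0 * W k‖
      ≤ ‖W k‖ * (Finset.range k).sum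
          (fun j => ‖wcasoratian A u W j‖ / (‖A j‖ * ‖W j‖ * ‖W (j + 1)‖)) := by
  have hrep := wtwo_point_representation A u W K hA hW k hk
  rw [hW0, div_one] at hrep
  have : u k - u 0 * W k
      = - (W k * (Finset.range k).sum (fun j => wcasoratian A u W j / (A j * W j * W (j + 1)))) := by
    rw [hrep]; ring
  rw [this, norm_neg, norm_mul]
  gcongr
  refine (norm_sum_le _ _).trans (le_of_eq ?_)
  apply Finset.sum_congr rfl
  intro j _
  rw [norm_div, norm_mul, norm_mul]

/-- PRINGSHEIM (ROW-DOMINANCE) TAIL LEMMA for general coefficients.  Rows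
`d (k+1) v k + a (k+1) v (k+2) = b (k+1) v (k+1)` for `K ≤ k ≤ M`, truncation `v (M+2) = 0`,
row dominance `‖a k‖ + ‖d k‖ ≤ ‖b k‖` and `d k ≠ 0` for `k ≥ K+1`: then `‖v (k+1)‖ ≤ ‖v k‖`
for `K ≤ k ≤ M+1`. -/
theorem pringsheim_monotone_gen (v a b d : ℕ → ℂ) (K M : ℕ)
    (hrow : ∀ k, K ≤ k → k ≤ M → d (k + 1) * v k + a (k + 1) * v (k + 2) = b (k + 1) * v (k + 1))
    (hdom : ∀ k, K + 1 ≤ k → ‖a k‖ + ‖d k‖ ≤ ‖b k‖) (hd : ∀ k, K + 1 ≤ k → 0 < ‖d k‖)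
    (hM : v (M + 2) = 0) :
    ∀ k, K ≤ k → k ≤ M + 1 → ‖v (k + 1)‖ ≤ ‖v k‖ := by
  have key : ∀ n k, k + n = M + 1 → K ≤ k → ‖v (k + 1)‖ ≤ ‖v k‖ := by
    intro n
    induction n with
    | zero =>
      intro k hk _
      have : k + 1 = M + 2 := by omega
      rw [this, hM, norm_zero]
      exact norm_nonneg _
    | succ n ih =>
      intro k hk hK
      have hkM : k ≤ M := by omega
      have ih' := ih (k + 1) (by omega) (by omega)
      have hr := hrow k hK hkM
      have hn : ‖b (k + 1)‖ * ‖v (k + 1)‖ ≤ ‖d (k + 1)‖ * ‖v k‖ + ‖a (k + 1)‖ * ‖v (k + 2)‖ := by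
        rw [← norm_mul, ← norm_mul, ← norm_mul, ← hr]
        exact norm_add_le _ _
      have hdom' := hdom (k + 1) (by omega)
      have hd' := hd (k + 1) (by omega)
      have hk2 : ‖v (k + 1 + 1)‖ = ‖v (k + 2)‖ := rfl
      rw [hk2] at ih'
      have h3 : ‖d (k + 1)‖ * ‖v (k + 1)‖ ≤ ‖d (k + 1)‖ * ‖v k‖ := by
        nlinarith [norm_nonneg (v (k + 1)), norm_nonneg (v (k + 2)), norm_nonneg (a (k + 1)),
          mul_le_mul_of_nonneg_left ih' (norm_nonneg (a (k + 1)))]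
      exact le_of_mul_le_mul_left h3 hd'
  intro k hK hk
  exact key (M + 1 - k) k (by omega) hK

/-- ROLL INSTANCE 1 (symmetriser).  At sites `n = k+2 ≥ 2` the transposed roll recurrence has
`a n = n-1`, `d n = n+1`; with `p n = 6/((n-1) n (n+1))` and `A n = 6/(n (n+1))` one has
`p (n) a (n) = A n` and `p n d n = A (n-1)` — written here for `n = k+3`. -/
theorem roll_symmetriser (k : ℕ) :
    (6 / (((k : ℂ) + 2) * ((k : ℂ) + 3) * ((k : ℂ) + 4))) * ((k : ℂ) + 2)
        = 6 / (((k : ℂ) + 3) * ((k : ℂ) + 4))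
    ∧ (6 / (((k : ℂ) + 2) * ((k : ℂ) + 3) * ((k : ℂ) + 4))) * ((k : ℂ) + 4)
        = 6 / (((k : ℂ) + 2) * ((k : ℂ) + 3)) := by
  have hk : (0 : ℝ) ≤ (k : ℝ) := Nat.cast_nonneg k
  have h2 : ((k : ℂ) + 2) ≠ 0 := by
    have : ((k : ℂ) + 2) = (((k : ℝ) + 2 : ℝ) : ℂ) := by push_cast; ring
    rw [this, Complex.ofReal_ne_zero]; linarith
  have h3 : ((k : ℂ) + 3) ≠ 0 := by
    have : ((k : ℂ) + 3) = (((k : ℝ) + 3 : ℝ) : ℂ) := by push_cast; ring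
    rw [this, Complex.ofReal_ne_zero]; linarith
  have h4 : ((k : ℂ) + 4) ≠ 0 := by
    have : ((k : ℂ) + 4) = (((k : ℝ) + 4 : ℝ) : ℂ) := by push_cast; ring
    rw [this, Complex.ofReal_ne_zero]; linarith
  constructor
  · field_simp
  · field_simp

/-- ROLL INSTANCE 2 (row dominance = the streak Pringsheim criterion).  Row `n` of the roll
recurrence, `(n+1) c (n-1) + (n-1) c (n+1) = (2n + n κ n) c n`, is dominant as soon as
`‖2 + κ n‖ ≥ 2` (`n ≥ 1`). -/
theorem roll_row_dominant (n : ℕ) (hn : 1 ≤ n) (κ : ℂ) (h : (2 : ℝ) ≤ ‖2 + κ‖) :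
    ‖((n : ℂ) - 1)‖ + ‖((n : ℂ) + 1)‖ ≤ ‖(2 * (n : ℂ) + (n : ℂ) * κ)‖ := by
  have hn' : (1 : ℝ) ≤ (n : ℝ) := by exact_mod_cast hn
  have e1 : ((n : ℂ) - 1) = (((n : ℝ) - 1 : ℝ) : ℂ) := by push_cast; ring
  have e2 : ((n : ℂ) + 1) = (((n : ℝ) + 1 : ℝ) : ℂ) := by push_cast; ring
  have e3 : (2 * (n : ℂ) + (n : ℂ) * κ) = (((n : ℝ) : ℝ) : ℂ) * (2 + κ) := by push_cast; ring
  rw [e1, e2, e3, norm_mul, Complex.norm_real, Complex.norm_real, Complex.norm_real,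
    Real.norm_of_nonneg (by linarith), Real.norm_of_nonneg (by linarith),
    Real.norm_of_nonneg (by linarith)]
  nlinarith [mul_le_mul_of_nonneg_left h (by linarith : (0 : ℝ) ≤ (n : ℝ))]

/-- ROLL INSTANCE 3 (column-2 residual).  With `h = -i/2`, the column-2 residual of the scaled
transposed roll recurrence (kernel #233 Thm 2, the `c₁` slot absent) is
`(h/2)(c₃ - 4c₂ - 2κ₂ c₂)`; defining the extension `c₁*` by the `n = 2` row,
`3 c₁* = (4 + 2κ₂) c₂ - c₃`, it equals `(3i/4) c₁*` — so `D_r = F_r/c₂ = (3i/4)·c₁*/c₂`. -/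
theorem roll_residual (c1 c2 c3 κ h : ℂ) (hh : h = -I / 2) (hc1 : 3 * c1 = (4 + 2 * κ) * c2 - c3) :
    h / 2 * (c3 - 4 * c2 - 2 * κ * c2) = (3 * I / 4) * c1 := by
  subst hh
  linear_combination (-I / 4) * hc1

/-- ROLL INSTANCE 4 (datum transfer).  With the normalisation `u₂ = W₂ = 1` the roll Jost data of
the true solution and of the comparison sequence differ by a quarter of the site-3 deviation:
`(3i/4)(4 + 2κ - u₃)/3 - (3i/4)(4 + 2κ - W₃)/3 = -(i/4)(u₃ - W₃)`, whence
`‖D_r - D_r^W‖ ≤ N·T₂/4` by the two-point estimate. -/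
theorem roll_datum_transfer (u3 W3 κ : ℂ) :
    (3 * I / 4) * ((4 + 2 * κ - u3) / 3) - (3 * I / 4) * ((4 + 2 * κ - W3) / 3)
      = -(I / 4) * (u3 - W3) := by
  ring

end Summit.AnomalousDissipation.AnomalousDissipation.Theorems
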